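import Summits.CriticalPhenomena.Ising3D.IsingColumnFaceL11CensusRadiiCore

/-!
# The catalogue census of §7.3 as kernel facts, VII-C: kernel evaluations for the `LIN` radius —
window `2` of the covering check and part `2` of the hole-window check (cell `pub-ising3x`, seat recog-1;
paper §1.6 / §7.3)

HONEST FRAMING: lottery ticket; floor = tightest certified 3D Ising CFT bounds; no exact-solution claim without a proof. Island framing: certified exclusion region at stated derivative order and
assumptions; not a determination of the 3D Ising critical exponents beyond that.

Two `decide +kernel` evaluations of the machine of `IsingColumnFaceL11CensusRadiiCore.lean` (see its header):
* `linCover_p2` — window `2` of `4` of the certified segment in units `linU = 10¹⁸·27720`: the kernel enumerates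
  the `LIN` candidates of the window (`linWin`; 30654 of them, by the Python twin), sorts their certified
  enclosures (`msortN`) and checks the chain with gap constant `linG` (`zgapsLE`);
* `linHole_part2` — part `2` (`linExcludedPart`, `ExclusionSentencesLin`) of the landed exhaustive `LIN` checker
  on the hole window `[linHoleA, linHoleB]` listing the two bounding tuples `linHoleX`, `linHoleY`.
Assembled in `…CensusRadiiLin.lean`. The heartbeat / recursion options are those of the cell's certificate files
(`Control2D…`): the evaluations are long, not deep. Pure arithmetic; no certificate, no datum, no σ–ε axiom;
nothing is recognised.
lottery ticket; floor = tightest certified 3D Ising CFT bounds; no exact-solution claim without a proof.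
-/

namespace Summit.CriticalPhenomena.Ising3D
namespace ColumnFaceL11
open Set Literature.MathematicalPhysics.QuantumFieldTheory.ConformalBootstrap3D

set_option maxHeartbeats 200000000 in
set_option maxRecDepth 200000 in
/-- `LIN` window `2`: start `36862998046874999999999`, end `37752934570312499999999 + linG` (units `linU`): every candidate
enclosure's upper end is within `linG` of the running reference point, up to the end. [folklore] -/
theorem linCover_p2 : linCover linG 36862998046874999999999 (37752934570312499999999 + linG) = true := by
  decide +kernel

set_option maxHeartbeats 200000000 in
set_option maxRecDepth 200000 in
/-- Part `2` of the landed `LIN` checker on the hole window lists only `linHoleX`, `linHoleY`. [folklore] -/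
theorem linHole_part2 : linExcludedPart 12 2 linHoleA linHoleB [linHoleX, linHoleY] = true := by
  decide +kernel

end ColumnFaceL11
end Summit.CriticalPhenomena.Ising3D
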